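import Literature.MathematicalPhysics.QuantumFieldTheory.Balaban1983to89.T4GaugeActionRateStrip
import Literature.MathematicalPhysics.QuantumFieldTheory.Balaban1983to89.T4RateAlgebra
import Literature.MathematicalPhysics.QuantumFieldTheory.Balaban1983to89.B4Green242Bridge

/-!
# `Balaban1983to89.T4GaugeActionRatePair` — the FIRST CONCRETE RATE PAIR: the unit-lattice position-space entry kernels of
Bałaban's `U = 1` effective gauge-field action `Δ_k` ((1.66) of [Balaban1984PropagatorsI], p. 29) satisfy the shared
T4/β η-rate hypothesis `T4RateAlgebra.RatePair` — (UD) k-uniform exponential decay AND (PR′) the one-step rate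
`|X_{k+1}(x) − X_k(x)| ≤ C′θ^k e^{−δ|x|₁}` with `θ = L⁻¹` — with explicit (crude, d-only) constants

T4-DAG (cell record `HOME/t4/T4-DAG.md`) node U1a / NE2, FAN-OUT prover seat P2 («direct spectral/Fourier estimate of the
linear block-spin map's contraction at rate η»), generation 2, continuation sub-row `T4-U1a.E-NE2-PROVE-P2b*`; companion of
`T4GaugeActionRateStrip` (same seat) and of the liaison module `T4RateAlgebra` (row T4-U1.S, pv25 lineage), whose header says:
*"whoever proves (UD)+(PR′) for the few PRIMITIVE unit-lattice kernels (the located missing estimate — T4 node U1 at the unit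
scale / BETA rows an1–an2) gets (UD)+(PR′) for every kernel assembled from them"*.  This module proves (UD)+(PR′) for ONE
primitive family: the (1.66) layer (cell object X8).

HONEST FRAMING (cell, verbatim from `HOME/t4/T4-DAG.md`): T4 is OPEN. The deliverables are: located quotations, a uniformity
census, typed hypothesis shapes, estimate sketches with every non-printed step flagged, and kernel-checked bookkeeping lemmas.
None of this is summit progress.  Rung (B)+1 scoping on finite `T⁴` blocks; NOT infinite volume, NOT a mass gap, NOT Clay.

ABSOLUTE RULE (cell, verbatim): No internally-minted statement may enter as a cited fact. Every hypothesis is either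
kernel-proved in this package or a verbatim quotation of a PUBLISHED theorem with page reference. The manuscript(s) under
audit are NOT citable for their own disputed steps — they are the thing under adjudication; programme-internal
(2001/route/tribunal) claims are never citable.

## The object

For `n ≥ 1`, `μ ≠ ν` and matrix indices `a, b`, b05-g9's continued entry symbol `Gsym n μ ν a b` (`B5Symbol166Strip` §6:
`½ · W₁₆₆(p) · (e^{−ip_a} − 1)(e^{ip_b} − 1)`, the continuation of `½ w_{μν}(p′) conj ∂¹_a(p′) ∂¹_b(p′)` of (1.66), `Gsym_ofReal`)
has the UNIT-LATTICE position-space kernel `K^{(n)}_{ab}(x) = (2π)^{−(d+1)} ∫_{[−π,π]^{d+1}} Gsym(p) e^{ip·x} dp =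
B4ContourShift.latticeKernel (Gsym n μ ν a b) x` (`x ∈ ℤ^{d+1}`; its periodisations are the torus kernels `ksum` of
`B5Kernel166Decay`, whose quadratic form reads the (1.66) action through REAL PARTS, `B5Kernel166Decay.inner_eq`).  The scalar
families of this module are the real parts `kerRe n μ ν a b x := Re K^{(n)}_{ab}(x)` along the scale ladder `n = L^k`:
`kerFamily L μ ν a b k x := kerRe (L^k) μ ν a b x` (§2), packaged β-style as `kerMatrix L μ ν : ℕ → B12Beta.Kernel (d+1)` (§3).

## What is here (all [folklore]-labelled theorems are elementary consequences of the two landed inputs named below)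

* §1 `l1_le_mul_supNorm`, `exp_sup_le_exp_l1`: `|x|₁ ≤ (d+1)|x|_∞`, so sup-norm decay at rate `κ` is `ℓ¹` decay at rate
  `κ/(d+1)` (the cell's `Decay510` predicate of [Balaban1987RG1] (5.10) is written with `|x|₁`).
* §2 `kerRe_decay` — (UD): `|Re K^{(n)}_{ab}(x)| ≤ MG(d+1) · e^{−(κ₁₆₆(d+1)/(d+1))|x|₁}` for EVERY `n ≥ 1` (b05-g9's
  `stripRegular_Gsym` + the tree's Paley–Wiener engine `B4ContourShift.latticeKernel_decay`); `kerRe_step` — (PR′) in the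
  two-lattice form: for `n₂ = R·n₁`, `|Re K^{(n₂)}_{ab}(x) − Re K^{(n₁)}_{ab}(x)| ≤ 8·CWs(d+1)·n₁⁻¹·e^{−δ₁₆₆(d)|x|₁}`,
  `δ₁₆₆(d) = κ₁₆₆(d+1)/(4(d+1)²)` (this seat's strip rate `T4GaugeActionRateStrip.latticeKernel_Gsym_rate` + linearity of the
  lattice kernel `B4Green242Bridge.latticeKernel_sub`).
* §3 `ratePair_kerFamily` — **`RatePair (kerFamily L μ ν a b) (MG(d+1)) (δ₁₆₆ d) (8·CWs(d+1)) (L⁻¹)`** for every `L ≥ 1`,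
  `μ ≠ ν`, `a`, `b`: the first instance in the tree of the shared hypothesis of `T4RateAlgebra` by a kernel of the series' linear
  layer (the module `T4RateAlgebra` has only the toy witness of its §5); `unitStepIneq_kerFamily` — the T4 reading
  (`T4RateAlgebra.UnitStepIneq`, = the body of `T4EtaRate.EtaRateIneqUnit` at `U = 1`, `inΛ := True`, `|·|₁`-distance);
  `uniformDecay_and_stepRate_kerMatrix` — the β reading (`Beta.LimitRate.UniformDecay ∧ StepRate` of the `(a,b)` component);
  `delta166_pos`, `theta_lt_one` (`L ≥ 2`) — the side conditions `0 < δ`, `0 ≤ θ < 1` of the consumers; `kernelInputs166` —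
  hence, for `a ≠ b` and `L ≥ 2`, the hypothesis STRUCTURE `Beta.LimitRate.KernelInputs (d+1) (kerMatrix L μ ν)` is inhabited
  (`T4RateAlgebra.kernelInputsOfRatePair`).  CAVEAT on the last item: `KernelInputs` is the β sub-cell's socket for the one-loop
  polarisation kernels `Π⁰_{k+1}`; `kerMatrix` is NOT `Π⁰` — it is ONE PRIMITIVE of the linear layer.  The one-loop dictionary
  assembling `Π⁰` from primitives (row an1; `T4RateAlgebra` header) and the other primitives (`H_k` (1.63), `G` (1.83): cell
  GAPS G-ne2p2-6) are NOT here; no β-function statement follows from this module.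

## What is NOT claimed

(1) Nothing printed is used as a hypothesis: the [cite] tags locate FORMULAS ((1.66) p. 29 of [Balaban1984PropagatorsI];
(1.22) p. 264 / (5.10) p. 293 of [Balaban1987RG1] for the β-side predicates; King's Lemma 4.5 (4.38) p. 674 of [King1986] is
the printed `A = 0` SIBLING of (PR′), not used).  (2) `U = 1`, `m² = 0`, LINEAR THEORY, the (1.66) layer ONLY; exponent
`γ = 1` (`θ = L⁻¹`), inherited from `T4GaugeActionRateStrip.W166_strip_rate` (King's convention `C·L^{−γk}`, `γ ≤ 1`);
constants crude and d-only (`MG`, `CWs`, `κ₁₆₆` of b05-g9 / this seat).  (3) NOT NE1′, NOT the background layer NE2⁺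
(`T4EtaRate.NE2PlusUnit`: typed missing inequality, record `HOME/t4/T4-EST-NE2-P2.md` (N4)), NOT continuum, NOT infinite-volume
Yang–Mills, NOT a mass gap, NOT Clay; the cell conditionals BetaPertH / (B) / (B^μ) do not enter.  Record:
`HOME/t4/T4-EST-NE2-P2.md`; NOT summit progress.
-/

namespace Literature.MathematicalPhysics.QuantumFieldTheory.Balaban1983to89.T4GaugeActionRatePair

open Complex
open Literature.MathematicalPhysics.QuantumFieldTheory.Balaban1983to89.B4ContourShift (StripRegular latticeKernel
  latticeKernel_decay supNorm supNorm_nonneg abs_le_supNorm)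
open Literature.MathematicalPhysics.QuantumFieldTheory.Balaban1983to89.B4Green242Bridge (latticeKernel_sub)
open Literature.MathematicalPhysics.QuantumFieldTheory.Balaban1983to89.B5Symbol166Strip (kappa166 kappa166_pos Gsym MG
  MG_pos stripRegular_Gsym)
open Literature.MathematicalPhysics.QuantumFieldTheory.Balaban1983to89.T4GaugeActionRateStrip (CWs CWs_nonneg
  latticeKernel_Gsym_rate)
open Literature.MathematicalPhysics.QuantumFieldTheory.Balaban1983to89.B12Sec2to5 (l1 l1_nonneg Decay510)
open Literature.MathematicalPhysics.QuantumFieldTheory.Balaban1983to89.T4RateAlgebra (RatePair step step_apply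
  UnitStepIneq unitStepIneq_iff ratePair_iff_uniformDecay_and_stepRate kernelInputsOfRatePair)
open Literature.MathematicalPhysics.QuantumFieldTheory.Balaban1983to89.Beta (decay510_mono)

noncomputable section

variable {d : ℕ}

/-! ## §1. Sup-norm decay is `ℓ¹` decay at rate `κ/(d+1)` -/

/-- `|x|₁ ≤ (d+1)·|x|_∞` on `ℤ^{d+1}`. [folklore] -/
theorem l1_le_mul_supNorm (x : Fin (d + 1) → ℤ) : l1 x ≤ ((d : ℝ) + 1) * supNorm x := by
  unfold l1
  calc ∑ μ, |((x μ : ℤ) : ℝ)| ≤ ∑ _μ : Fin (d + 1), supNorm x := Finset.sum_le_sum fun i _ => by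
          have h := abs_le_supNorm x i
          rwa [Int.cast_abs] at h
    _ = ((d : ℝ) + 1) * supNorm x := by
          rw [Finset.sum_const, Finset.card_univ, Fintype.card_fin, nsmul_eq_mul]; push_cast; ring

/-- … hence `e^{−κ|x|_∞} ≤ e^{−(κ/(d+1))|x|₁}` for `κ ≥ 0`. [folklore] -/
theorem exp_sup_le_exp_l1 {κ : ℝ} (hκ : 0 ≤ κ) (x : Fin (d + 1) → ℤ) :
    Real.exp (-(κ * supNorm x)) ≤ Real.exp (-(κ / ((d : ℝ) + 1)) * l1 x) := by
  rw [Real.exp_le_exp]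
  have hd : (0 : ℝ) < (d : ℝ) + 1 := by positivity
  have h := l1_le_mul_supNorm x
  have h2 : κ / ((d : ℝ) + 1) * l1 x ≤ κ * supNorm x := by
    rw [div_mul_eq_mul_div, div_le_iff₀ hd]
    calc κ * l1 x ≤ κ * (((d : ℝ) + 1) * supNorm x) := mul_le_mul_of_nonneg_left h hκ
      _ = κ * supNorm x * ((d : ℝ) + 1) := by ring
  linarith

/-! ## §2. The unit-lattice entry kernels of the (1.66) layer: (UD) and the two-lattice step bound -/

/-- `Re K^{(n)}_{ab}(x)`: the real part of the unit-lattice position-space kernel of b05-g9's continued entry symbol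
`Gsym n μ ν a b` of (1.66) (`K = B4ContourShift.latticeKernel`, the normalised Fourier coefficient over `[−π,π]^{d+1}`).
[cite: Balaban1984PropagatorsI, (1.66) p.29] -/
def kerRe (n : ℕ) [NeZero n] (μ ν a b : Fin (d + 1)) (x : Fin (d + 1) → ℤ) : ℝ :=
  (latticeKernel (fun p => Gsym n μ ν a b p) x).re

/-- **(UD) for the (1.66) entry kernels**, every `n ≥ 1`: `|Re K^{(n)}_{ab}(x)| ≤ MG(d+1)·e^{−(κ₁₆₆(d+1)/(d+1))|x|₁}`
(strip regularity `stripRegular_Gsym` at full width + Paley–Wiener `latticeKernel_decay` + §1). [folklore] -/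
theorem kerRe_decay (n : ℕ) [NeZero n] {μ ν : Fin (d + 1)} (hμν : μ ≠ ν) (a b : Fin (d + 1)) :
    Decay510 (kerRe (d := d) n μ ν a b) (MG (d + 1)) (kappa166 (d + 1) / ((d : ℝ) + 1)) := by
  intro x
  have hκ : 0 ≤ kappa166 (d + 1) := (kappa166_pos (d + 1)).le
  have h1 := latticeKernel_decay (stripRegular_Gsym (d := d) n hκ le_rfl hμν a b) hκ x
  have h2 := exp_sup_le_exp_l1 (d := d) hκ x
  calc |kerRe n μ ν a b x| ≤ ‖latticeKernel (fun p => Gsym n μ ν a b p) x‖ := by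
          unfold kerRe; exact abs_re_le_norm _
    _ ≤ MG (d + 1) * Real.exp (-(kappa166 (d + 1) * supNorm x)) := h1
    _ ≤ MG (d + 1) * Real.exp (-(kappa166 (d + 1) / ((d : ℝ) + 1)) * l1 x) :=
        mul_le_mul_of_nonneg_left h2 (MG_pos _).le

/-- The `ℓ¹` decay rate of the one-step bound: `δ₁₆₆(d) = κ₁₆₆(d+1)/(4(d+1)) / (d+1)` (the strip width of
`T4GaugeActionRateStrip.latticeKernel_Gsym_rate` divided by the sup-to-`ℓ¹` conversion factor). [folklore] -/
def delta166 (d : ℕ) : ℝ := kappa166 (d + 1) / (4 * ((d : ℝ) + 1)) / ((d : ℝ) + 1)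

/-- `0 < δ₁₆₆(d)`. [folklore] -/
theorem delta166_pos (d : ℕ) : 0 < delta166 d := by
  unfold delta166; have := kappa166_pos (d + 1); positivity

/-- `δ₁₆₆(d) ≤ κ₁₆₆(d+1)/(d+1)` (the (UD) rate of `kerRe_decay`). [folklore] -/
theorem delta166_le (d : ℕ) : delta166 d ≤ kappa166 (d + 1) / ((d : ℝ) + 1) := by
  unfold delta166
  have hκ := (kappa166_pos (d + 1)).le
  have hd : (0 : ℝ) < (d : ℝ) + 1 := by positivity
  have h4 : kappa166 (d + 1) / (4 * ((d : ℝ) + 1)) ≤ kappa166 (d + 1) := by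
    rw [div_le_iff₀ (by positivity)]
    nlinarith
  exact div_le_div_of_nonneg_right h4 hd.le

/-- **The two-lattice step bound for the (1.66) entry kernels** (`n₂ = R·n₁`, `μ ≠ ν`):
`|Re K^{(n₂)}_{ab}(x) − Re K^{(n₁)}_{ab}(x)| ≤ 8·CWs(d+1)·n₁⁻¹·e^{−δ₁₆₆(d)|x|₁}` — this seat's strip rate
`latticeKernel_Gsym_rate` (exponent `γ = 1`) + linearity of the lattice kernel + §1. [folklore] -/
theorem kerRe_step {n₁ n₂ R : ℕ} [NeZero n₁] [NeZero n₂] (h : n₂ = R * n₁) {μ ν : Fin (d + 1)} (hμν : μ ≠ ν)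
    (a b : Fin (d + 1)) (x : Fin (d + 1) → ℤ) :
    |kerRe n₂ μ ν a b x - kerRe n₁ μ ν a b x|
      ≤ 8 * CWs (d + 1) * (n₁ : ℝ)⁻¹ * Real.exp (-(delta166 d) * l1 x) := by
  have hκ : 0 ≤ kappa166 (d + 1) := (kappa166_pos (d + 1)).le
  have hκ0 : 0 ≤ kappa166 (d + 1) / (4 * ((d : ℝ) + 1)) := by have := kappa166_pos (d + 1); positivity
  have I₁ := (stripRegular_Gsym (d := d) n₁ hκ le_rfl hμν a b).integrableOn hκ x
  have I₂ := (stripRegular_Gsym (d := d) n₂ hκ le_rfl hμν a b).integrableOn hκ x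
  have hsub : latticeKernel (fun p => Gsym n₂ μ ν a b p - Gsym n₁ μ ν a b p) x
      = latticeKernel (fun p => Gsym n₂ μ ν a b p) x - latticeKernel (fun p => Gsym n₁ μ ν a b p) x :=
    latticeKernel_sub x I₂ I₁
  have hr := latticeKernel_Gsym_rate (d := d) h hμν a b x
  rw [hsub] at hr
  have h2 := exp_sup_le_exp_l1 (d := d) hκ0 x
  have hC : 0 ≤ 8 * CWs (d + 1) * (n₁ : ℝ)⁻¹ := by have := CWs_nonneg (d + 1); positivity
  calc |kerRe n₂ μ ν a b x - kerRe n₁ μ ν a b x|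
        = |(latticeKernel (fun p => Gsym n₂ μ ν a b p) x - latticeKernel (fun p => Gsym n₁ μ ν a b p) x).re| := by
          simp only [kerRe, Complex.sub_re]
    _ ≤ ‖latticeKernel (fun p => Gsym n₂ μ ν a b p) x - latticeKernel (fun p => Gsym n₁ μ ν a b p) x‖ :=
          abs_re_le_norm _
    _ ≤ 8 * CWs (d + 1) * (n₁ : ℝ)⁻¹
          * Real.exp (-(kappa166 (d + 1) / (4 * ((d : ℝ) + 1)) * supNorm x)) := hr
    _ ≤ 8 * CWs (d + 1) * (n₁ : ℝ)⁻¹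
          * Real.exp (-(kappa166 (d + 1) / (4 * ((d : ℝ) + 1)) / ((d : ℝ) + 1)) * l1 x) :=
          mul_le_mul_of_nonneg_left h2 hC
    _ = 8 * CWs (d + 1) * (n₁ : ℝ)⁻¹ * Real.exp (-(delta166 d) * l1 x) := by rw [delta166]

/-! ## §3. The rate pair along the scale ladder `n = L^k`, and its T4 / β readings -/

/-- The scale-indexed family `X_k(x) = Re K^{(L^k)}_{ab}(x)` of unit-lattice (1.66) entry kernels (`η = L^{−k}` inside the
unit lattice; `L ≥ 1`). [cite: Balaban1984PropagatorsI, (1.66) p.29] -/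
def kerFamily (L : ℕ) [NeZero L] (μ ν a b : Fin (d + 1)) : ℕ → (Fin (d + 1) → ℤ) → ℝ :=
  fun k x => kerRe (L ^ k) μ ν a b x

/-- **RATE PAIR FOR THE (1.66) LAYER**: for every `L ≥ 1`, `μ ≠ ν`, `a`, `b`,
`RatePair (kerFamily L μ ν a b) (MG(d+1)) (δ₁₆₆ d) (8·CWs(d+1)) (L⁻¹)` — (UD) `|X_k(x)| ≤ MG·e^{−δ₁₆₆|x|₁}` uniformly in
`k` and (PR′) `|X_{k+1}(x) − X_k(x)| ≤ 8·CWs·L^{−k}·e^{−δ₁₆₆|x|₁}`.  The shared hypothesis of `T4RateAlgebra` is thereby a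
THEOREM for this primitive family (it stays a hypothesis for `H_k`, `G` and everything with background). [folklore] -/
theorem ratePair_kerFamily (L : ℕ) [NeZero L] {μ ν : Fin (d + 1)} (hμν : μ ≠ ν) (a b : Fin (d + 1)) :
    RatePair (kerFamily (d := d) L μ ν a b) (MG (d + 1)) (delta166 d) (8 * CWs (d + 1)) ((L : ℝ)⁻¹) where
  decay k := decay510_mono (kerRe_decay (d := d) (L ^ k) hμν a b) (delta166_le d)
  rate k := by
    intro x
    have h := kerRe_step (d := d) (n₁ := L ^ k) (n₂ := L ^ (k + 1)) (R := L) (pow_succ' L k) hμν a b x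
    rw [Nat.cast_pow, ← inv_pow] at h
    rw [step_apply]
    exact h

/-- **T4 reading**: the unit-lattice inequality `T4RateAlgebra.UnitStepIneq` (= the body of `T4EtaRate.EtaRateIneqUnit` at
`U = 1`, `inΛ := True`, `|·|₁`-distance) HOLDS for the (1.66) entry kernels with `B₀ = 8·CWs(d+1)`, `δ₀ = δ₁₆₆(d)`,
`θ = L⁻¹`. [folklore] -/
theorem unitStepIneq_kerFamily (L : ℕ) [NeZero L] {μ ν : Fin (d + 1)} (hμν : μ ≠ ν) (a b : Fin (d + 1)) :
    UnitStepIneq (kerFamily (d := d) L μ ν a b) (8 * CWs (d + 1)) (delta166 d) ((L : ℝ)⁻¹) :=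
  (unitStepIneq_iff _ _ _ _).mpr (ratePair_kerFamily L hμν a b).rate

/-- The same kernels packaged β-style: `kerMatrix L μ ν k a b x = Re K^{(L^k)}_{ab}(x)` as a scale-indexed
`B12Beta.Kernel (d+1)`-valued family (matrix indices `a, b`).  NOT the one-loop kernel `Π⁰` of [Balaban1987RG1] (1.22): one
PRIMITIVE of the linear layer. [cite: Balaban1984PropagatorsI, (1.66) p.29] -/
def kerMatrix (L : ℕ) [NeZero L] (μ ν : Fin (d + 1)) : ℕ → B12Beta.Kernel (d + 1) :=
  fun k a b x => kerRe (L ^ k) μ ν a b x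

/-- **β reading**: `UniformDecay ∧ StepRate` (`Beta.LimitRate`) of every `(a,b)` component of `kerMatrix L μ ν`, constants
`MG(d+1)`, `δ₁₆₆(d)`, `8·CWs(d+1)`, `θ = L⁻¹` (`T4RateAlgebra.ratePair_iff_uniformDecay_and_stepRate`). [folklore] -/
theorem uniformDecay_and_stepRate_kerMatrix (L : ℕ) [NeZero L] {μ ν : Fin (d + 1)} (hμν : μ ≠ ν)
    (a b : Fin (d + 1)) :
    Beta.LimitRate.UniformDecay (kerMatrix (d := d) L μ ν) a b (MG (d + 1)) (delta166 d) ∧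
      Beta.LimitRate.StepRate (kerMatrix (d := d) L μ ν) a b (8 * CWs (d + 1)) (delta166 d) ((L : ℝ)⁻¹) :=
  (ratePair_iff_uniformDecay_and_stepRate (kerMatrix L μ ν) a b _ _ _ _).mp (ratePair_kerFamily L hμν a b)

/-- `θ = L⁻¹ < 1` for `L ≥ 2`. [folklore] -/
theorem theta_lt_one {L : ℕ} (hL : 2 ≤ L) : ((L : ℝ)⁻¹) < 1 :=
  inv_lt_one_of_one_lt₀ (by exact_mod_cast hL)

/-- `0 ≤ θ = L⁻¹`. [folklore] -/
theorem theta_nonneg (L : ℕ) : 0 ≤ ((L : ℝ)⁻¹) := inv_nonneg.mpr (Nat.cast_nonneg L)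

/-- … hence, for `L ≥ 2`, `μ ≠ ν` and an OFF-DIAGONAL matrix entry `a ≠ b`, the β sub-cell's hypothesis structure
`Beta.LimitRate.KernelInputs (d+1) (kerMatrix L μ ν)` is INHABITED by this primitive family
(`T4RateAlgebra.kernelInputsOfRatePair`).  CAVEAT: `KernelInputs` is the socket for the one-loop polarisation kernels
`Π⁰_{k+1}`; `kerMatrix` is NOT `Π⁰`, and no one-loop dictionary / β-function statement is supplied or implied here — the value
is that the socket's hypotheses are met by a genuine kernel family of the series' linear layer, not only by the toy witness of
`T4RateAlgebra` §5. [cite: Balaban1987RG1, (1.22) p.264] -/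
def kernelInputs166 (L : ℕ) [NeZero L] (hL : 2 ≤ L) {μ ν : Fin (d + 1)} (hμν : μ ≠ ν) {a b : Fin (d + 1)}
    (hab : a ≠ b) : Beta.LimitRate.KernelInputs (d + 1) (kerMatrix (d := d) L μ ν) :=
  kernelInputsOfRatePair hab (delta166_pos d) (theta_nonneg L) (theta_lt_one hL) (ratePair_kerFamily L hμν a b)

/-- Summary in the consumers' quantifier shape: for every `L ≥ 2`, `μ ≠ ν`, `a`, `b` there are constants `C, δ, C′ > 0`-side
data and `θ ∈ [0,1)` — namely `MG(d+1)`, `δ₁₆₆(d)`, `8·CWs(d+1)`, `L⁻¹` — with `0 < δ`, `0 ≤ θ < 1` and the rate pair.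
[folklore] -/
theorem exists_ratePair_166 (L : ℕ) [NeZero L] (hL : 2 ≤ L) {μ ν : Fin (d + 1)} (hμν : μ ≠ ν)
    (a b : Fin (d + 1)) :
    ∃ C δ C' θ : ℝ, 0 < δ ∧ 0 ≤ θ ∧ θ < 1 ∧ RatePair (kerFamily (d := d) L μ ν a b) C δ C' θ :=
  ⟨_, _, _, _, delta166_pos d, theta_nonneg L, theta_lt_one hL, ratePair_kerFamily L hμν a b⟩

end

end Literature.MathematicalPhysics.QuantumFieldTheory.Balaban1983to89.T4GaugeActionRatePair
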